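import Summits.BirchSwinnertonDyer.Rank1Residual.O6.X3KatoMemberBound
import Summits.BirchSwinnertonDyer.Rank1Residual.Additive.QuadraticTwistBSDComparisonIsogeny
import Summits.BirchSwinnertonDyer.Rank1Residual.Additive.PotSupersingularClasses
import HarnessLib

/-!
# Route `KatoDescentPotSupersingular` (rung K9, cell `bsd-potss`): the reducible-defect crux
# `WildUpperReducibleDefect` (item stmt-BirchSwinnertonDyer-19190) is LOAD-BEARING ONLY ON THE
# `3`-TORSION CLASSES — a ROUTE-FREE node theorem over the unfolded item bodies (a
# `--supports … --as helper` file; seat `bsd-potss-k9-c4` g3; nothing booked, BSD is not proved by any of this)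

The U₀ parent `WildUpperDefectRankZero` (item 19197) is derived in `closes` from its two row children,
the irreducible tower-non-surjective rows (19189, from the Conj-A crux 19386 and the Heegner road) and
the REDUCIBLE defect rows `WildUpperReducibleDefect` (19190): `E[3]` reducible, analytic rank `0`,
`ClassO6` at `3`, with a `ℤ/9`-member in the isogeny class OR odd `ord₃ #Ш_an`. The rank-`0` assembly
(`WildRankZeroAssembly`, 19199, closed) covers the complementary reducible rows through the member
bound M = `ReducibleKatoMember` (19196) = `O6.KatoMemberShaBoundOfReducible`: at Kato's member `W'`,
`ord_p #Ш(W') ≤ ord_p #Ш_an(W') + ord_p #W'(ℚ)_tors` (seat rkm's defect form,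
`…ReducibleKatoMemberDefect` §2, over `O6.exists_shaAn_le_add_torsion_of_katoCurrency`), the class
defect `δ_p = ord_p #Ш − ord_p #Ш_an` being a class constant (Cassels,
`TwistComparison.defectAgreeAt_of_isIsogenous`); one unit of torsion slack is absorbed by parity.

OBSERVATION (this file, kernel): on an isogeny class in which NO member has a rational point of order
`p` (for `E[p]` reducible with isogeny character `χ`: `χ ∉ {1, ω}`; rkm's census C-X3K-0 at the wild
prime: `t_max = 0` on `4 611` of the `9 476` X3 ∧ O6 ∧ r0 classes with `N ≤ 5·10⁵`) the member bound
has NO slack at all, so M + Cassels + GZK + modularity give the UPPER half on every member, ANY parity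
and with no `ℤ/p²` clause — `missingUpperBoundAt_of_katoMember_of_forall_not_dvd_torsionOrder`
(§1, every odd additive potentially good `p`; it serves the (t′) twin 19203 verbatim at `p ≥ 11`, where
no (t′) class carries rational `p`-torsion). Hence (§2) the BODY of `WildUpperReducibleDefect` follows
from the BODY of `ReducibleKatoMember` + the three published inputs + the defect statement RESTRICTED to
the classes with a `3`-torsion member (`upperReducibleDefect_of_katoMember_of_torsionClasses`): the
crux 19190 is load-bearing only on its `3`-torsion classes (`t_max ≥ 1`: the `3` `ℤ/9`-classes `54b`,
`1890r`, `122094bl` and the odd-parity rows among the `4 862` `t_max = 1` classes — the latter EMPTY if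
BSD₃ holds, but not provably so). The file imports NO `Theses.*` module, so a planner re-cut of 19190
(K9 analogue of TARGET R99) may CALL §2 from `closes` with `h₃ : ReducibleKatoMember` and the
conjuncts of `PublishedInputsO6` / `KatoTamagawaExactInputs` (defeq unfolding of the route decls, as
for seat k8t-c4's `TameUpperReducibleNodes`). Conditional on the displayed named facts (audit
`proof.conditional`); no item is closed here.

References: [Kato2004Asterisque] Thm. 12.6 (p. 222), Thm. 14.5 (3) (p. 236), Prop. 14.16 (2) (p. 244);
[Cassels1965ArithmeticVIII]; [MilneADT2006] Thm. I.7.3, Rem. I.7.4; [Miller2011LMS] §1, Def. 1.1;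
[Wuthrich2014] Lemma 12, Lemma 14.
-/

set_option autoImplicit false
-- sibling precedent (`KatoDescentPotSupersingularAssembly.lean`): the directory name repeats the summit name
set_option linter.dupNamespace false

noncomputable section

open scoped Classical

namespace Summit.BirchSwinnertonDyer.BirchSwinnertonDyer.Theorems.WildUpperReducibleNodes

open WeierstrassCurve Literature.NumberTheory.EllipticCurves
  Literature.NumberTheory.EllipticCurves.Rank1Residual
  Literature.NumberTheory.EllipticCurves.Rank1Residual.Typed
  Summit.BirchSwinnertonDyer.Rank1Residual Summit.BirchSwinnertonDyer.Rank1Residual.Additive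

/-! ## §1 The member bound has no slack on a `p`-torsion-free class -/

/-- **UPPER half from Kato's member bound on a class without rational `p`-torsion.** Granted Cassels'
isogeny invariance of the BSD quotient (`hCassels`), GZK (`hGZK`), modularity (`hmod`) and the member
bound M (`hM` = the body of item 19196, `O6.KatoMemberShaBoundOfReducible`): for `W/ℚ` globally
minimal of analytic rank `0` at an odd prime `p` of additive, potentially good reduction with `W[p]`
reducible, if NO elliptic curve `ℚ`-isogenous to `W` has a rational point of order `p` (`htf`), then
`ord_p #Ш(W) ≤ ord_p #Ш_an(W)` (`MissingUpperBoundAt W p`). Proof: at Kato's member `W'`,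
`ord_p #Ш(W') ≤ ord_p #Ш_an(W') + ord_p #W'(ℚ)_tors = ord_p #Ш_an(W')`
(`O6.exists_shaAn_le_add_torsion_of_katoCurrency`, `htf W'`), and the defect is a class constant
(`TwistComparison.defectAgreeAt_of_isIsogenous`). Any parity, no `ℤ/p²` clause. Conditional; nothing
booked. [cite: Kato2004Asterisque, Thm. 12.6 (p. 222), Prop. 14.16 (2) (p. 244)]
[cite: Cassels1965ArithmeticVIII] [cite: MilneADT2006, Thm. I.7.3] [cite: Miller2011LMS, Def. 1.1] -/
theorem missingUpperBoundAt_of_katoMember_of_forall_not_dvd_torsionOrder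
    (hCassels : bsdRHS_eq_of_isIsogenous) (hGZK : rank_eq_analyticRank_of_analyticRank_le_one)
    (hmod : hasEntireLFunction_rat) (hM : O6.KatoMemberShaBoundOfReducible)
    (W : WeierstrassCurve ℚ) [W.IsElliptic] [W.IsGloballyMinimal] (p : ℕ) [Fact p.Prime]
    (hp : p ≠ 2) (hgood : ¬ W.HasGoodReductionAtPrime p)
    (hmult : ¬ W.HasMultiplicativeReductionAtPrime p) (hj : 0 ≤ padicValRat p W.j)
    (hred : ¬ W.HasIrreducibleModPGaloisRep p) (hr : W.analyticRank = 0)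
    (htf : ∀ (W' : WeierstrassCurve ℚ) [W'.IsElliptic], IsIsogenous W W' → ¬ p ∣ W'.torsionOrder) :
    MissingUpperBoundAt W p := by
  have hL : W.entireLFunction 1 ≠ 0 := (W.analyticRank_eq_zero_iff_holds (hmod W)).mp hr
  have hfin : Finite W.sha := (hGZK W (by rw [hr]; exact zero_le_one)).2
  -- Kato's member `W'` with the A161″ inequality (slack `3t`)
  obtain ⟨W', hE', hM', hiso, hfin', q, hq, hle⟩ := hM W p hp hgood hmult hj hred hL hfin
  haveI := hE'
  haveI := hM'
  have hfin'S : W'.ShaFinite := hfin'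
  have hr' : W'.analyticRank = 0 := by rw [← analyticRank_eq_of_isIsogenous' hiso, hr]
  -- Miller currency at the member: `ord Ш(W') ≤ ord #Ш_an(W') + t(W')`, and `t(W') = 0`
  obtain ⟨q', hq', hW'⟩ := O6.exists_shaAn_le_add_torsion_of_katoCurrency hGZK hmod W' p hr' hfin' hq hle
  have ht : padicValNat p W'.torsionOrder = 0 := padicValNat.eq_zero_of_not_dvd (htf W' hiso)
  rw [ht, Nat.cast_zero, add_zero] at hW'
  -- the defect is a class constant (Cassels): transport from `W'` to `W`
  obtain ⟨r, r', hr0, hrW, hδ⟩ :=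
    TwistComparison.defectAgreeAt_of_isIsogenous W' W p hCassels hmod hiso.symm_of_isElliptic hfin'S hq'
  have hrq : r = q' := by exact_mod_cast hr0.symm.trans hq'
  rw [hrq] at hδ
  exact ⟨r', hrW, by linarith⟩

/-- **The same at the wild prime, on the O6 rows** (`ClassO6 W 3` supplies `3 ≠ 2`, additivity and
`ord₃ j ≥ 0`): on a reducible O6 row of analytic rank `0` whose isogeny class has no rational
`3`-torsion, the upper half `MissingUpperBoundAt W 3` follows from M + Cassels + GZK + modularity —
any parity. Conditional; nothing booked. [cite: Kato2004Asterisque, Thm. 12.6 (p. 222), Prop. 14.16 (2) (p. 244)]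
[cite: Cassels1965ArithmeticVIII] [cite: Miller2011LMS, Def. 1.1] -/
theorem missingUpperBoundAt_wildRed_of_katoMember_of_forall_not_dvd_torsionOrder
    (hCassels : bsdRHS_eq_of_isIsogenous) (hGZK : rank_eq_analyticRank_of_analyticRank_le_one)
    (hmod : hasEntireLFunction_rat) (hM : O6.KatoMemberShaBoundOfReducible)
    (W : WeierstrassCurve ℚ) [W.IsElliptic] [W.IsGloballyMinimal] [Fact (3 : ℕ).Prime]
    (hr : W.analyticRank = 0) (hO : ClassO6 W 3) (hred : ¬ W.HasIrreducibleModPGaloisRep 3)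
    (htf : ∀ (W' : WeierstrassCurve ℚ) [W'.IsElliptic], IsIsogenous W W' → ¬ 3 ∣ W'.torsionOrder) :
    MissingUpperBoundAt W 3 :=
  missingUpperBoundAt_of_katoMember_of_forall_not_dvd_torsionOrder hCassels hGZK hmod hM W 3 hO.1
    hO.2.1.1 hO.2.1.2 hO.padicValRat_j_nonneg hred hr htf

/-! ## §2 The node theorem: `WildUpperReducibleDefect` is load-bearing only on the `3`-torsion classes -/

/-- **ROUTE-FREE NODE THEOREM for item 19190.** Granted Cassels (`hCassels`), GZK (`hGZK`), modularity
(`hmod`) — conjuncts of the route's cite-level items — and the BODY of the crux M `ReducibleKatoMember`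
(`hM`): if the upper half holds on the reducible O6 defect rows (a `ℤ/9`-member or odd `ord₃ #Ш_an`)
WHOSE ISOGENY CLASS HAS A MEMBER WITH A RATIONAL `3`-TORSION POINT (hypothesis `hT` — the honest
residue: `t_max ≥ 1`, where Kato's member bound keeps one or two units of torsion slack), then the BODY
of the route decl `WildUpperReducibleDefect` holds verbatim: the `3`-torsion-free classes come from §1.
So a re-cut `19190 := hT` is dominated inside `closes` by `h₃` + published inputs + this term
(`exact WildUpperReducibleNodes.upperReducibleDefect_of_katoMember_of_torsionClasses hC hGZK hmod h₃ hT`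
elaborates against the route decls by defeq unfolding). Conditional; the item is NOT closed.
[cite: Kato2004Asterisque, Thm. 12.6 (p. 222), Prop. 14.16 (2) (p. 244)] [cite: Cassels1965ArithmeticVIII]
[cite: Miller2011LMS, §1 and Def. 1.1] -/
theorem upperReducibleDefect_of_katoMember_of_torsionClasses
    (hCassels : bsdRHS_eq_of_isIsogenous) (hGZK : rank_eq_analyticRank_of_analyticRank_le_one)
    (hmod : hasEntireLFunction_rat) (hM : O6.KatoMemberShaBoundOfReducible)
    (hT : ∀ (W : WeierstrassCurve ℚ) [W.IsElliptic] [W.IsGloballyMinimal] [Fact (3 : ℕ).Prime],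
      W.analyticRank = 0 → ClassO6 W 3 → ¬ W.HasIrreducibleModPGaloisRep 3 →
      ¬ ((∀ (W' : WeierstrassCurve ℚ) [W'.IsElliptic], IsIsogenous W W' → ¬ 3 ^ 2 ∣ W'.torsionOrder) ∧
          ∀ q : ℚ, shaAn W = (q : ℂ) → Even (padicValRat 3 q)) →
      (∃ (W' : WeierstrassCurve ℚ) (_ : W'.IsElliptic), IsIsogenous W W' ∧ 3 ∣ W'.torsionOrder) →
      MissingUpperBoundAt W 3) :
    ∀ (W : WeierstrassCurve ℚ) [W.IsElliptic] [W.IsGloballyMinimal] [Fact (3 : ℕ).Prime],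
      W.analyticRank = 0 → ClassO6 W 3 → ¬ W.HasIrreducibleModPGaloisRep 3 →
      ¬ ((∀ (W' : WeierstrassCurve ℚ) [W'.IsElliptic], IsIsogenous W W' → ¬ 3 ^ 2 ∣ W'.torsionOrder) ∧
          ∀ q : ℚ, shaAn W = (q : ℂ) → Even (padicValRat 3 q)) →
      MissingUpperBoundAt W 3 := by
  intro W _ _ _ hr hO hred hdef
  by_cases htors : ∃ (W' : WeierstrassCurve ℚ) (_ : W'.IsElliptic), IsIsogenous W W' ∧ 3 ∣ W'.torsionOrder
  · exact hT W hr hO hred hdef htors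
  · push Not at htors
    exact missingUpperBoundAt_wildRed_of_katoMember_of_forall_not_dvd_torsionOrder hCassels hGZK hmod hM
      W hr hO hred fun W' _ hiso ↦ htors W' inferInstance hiso

/-- **Corollary: on the `3`-torsion classes only the ODD-PARITY / `ℤ/9` rows remain, and the two
disjuncts separate.** The same node theorem with `hT` split into its two natural residues: (a) the
classes with a `ℤ/9`-member (`t_max = 2`; census: `54b`, `1890r`, `122094bl` below `5·10⁵`), (b) the
odd-parity rows on classes with `t_max = 1` (a `ℤ/3`- but no `ℤ/9`-member; EMPTY under BSD₃, not
provably so). Bookkeeping over §2. [cite: Kato2004Asterisque, Thm. 12.6 (p. 222)] [cite: Miller2011LMS, Def. 1.1] -/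
theorem upperReducibleDefect_of_katoMember_of_nineClasses_of_oddTorsionClasses
    (hCassels : bsdRHS_eq_of_isIsogenous) (hGZK : rank_eq_analyticRank_of_analyticRank_le_one)
    (hmod : hasEntireLFunction_rat) (hM : O6.KatoMemberShaBoundOfReducible)
    (hNine : ∀ (W : WeierstrassCurve ℚ) [W.IsElliptic] [W.IsGloballyMinimal] [Fact (3 : ℕ).Prime],
      W.analyticRank = 0 → ClassO6 W 3 → ¬ W.HasIrreducibleModPGaloisRep 3 →
      (∃ (W' : WeierstrassCurve ℚ) (_ : W'.IsElliptic), IsIsogenous W W' ∧ 3 ^ 2 ∣ W'.torsionOrder) →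
      MissingUpperBoundAt W 3)
    (hOdd : ∀ (W : WeierstrassCurve ℚ) [W.IsElliptic] [W.IsGloballyMinimal] [Fact (3 : ℕ).Prime],
      W.analyticRank = 0 → ClassO6 W 3 → ¬ W.HasIrreducibleModPGaloisRep 3 →
      (∀ (W' : WeierstrassCurve ℚ) [W'.IsElliptic], IsIsogenous W W' → ¬ 3 ^ 2 ∣ W'.torsionOrder) →
      (∃ (W' : WeierstrassCurve ℚ) (_ : W'.IsElliptic), IsIsogenous W W' ∧ 3 ∣ W'.torsionOrder) →
      (∃ q : ℚ, shaAn W = (q : ℂ) ∧ ¬ Even (padicValRat 3 q)) →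
      MissingUpperBoundAt W 3) :
    ∀ (W : WeierstrassCurve ℚ) [W.IsElliptic] [W.IsGloballyMinimal] [Fact (3 : ℕ).Prime],
      W.analyticRank = 0 → ClassO6 W 3 → ¬ W.HasIrreducibleModPGaloisRep 3 →
      ¬ ((∀ (W' : WeierstrassCurve ℚ) [W'.IsElliptic], IsIsogenous W W' → ¬ 3 ^ 2 ∣ W'.torsionOrder) ∧
          ∀ q : ℚ, shaAn W = (q : ℂ) → Even (padicValRat 3 q)) →
      MissingUpperBoundAt W 3 := by
  refine upperReducibleDefect_of_katoMember_of_torsionClasses hCassels hGZK hmod hM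
    fun W _ _ _ hr hO hred hdef htors ↦ ?_
  by_cases hnine : ∃ (W' : WeierstrassCurve ℚ) (_ : W'.IsElliptic), IsIsogenous W W' ∧ 3 ^ 2 ∣ W'.torsionOrder
  · exact hNine W hr hO hred hnine
  · push Not at hnine
    have hno9 : ∀ (W' : WeierstrassCurve ℚ) [W'.IsElliptic], IsIsogenous W W' → ¬ 3 ^ 2 ∣ W'.torsionOrder :=
      fun W' _ hiso ↦ hnine W' inferInstance hiso
    have hodd : ∃ q : ℚ, shaAn W = (q : ℂ) ∧ ¬ Even (padicValRat 3 q) := by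
      by_contra hcon
      push Not at hcon
      exact hdef ⟨hno9, hcon⟩
    exact hOdd W hr hO hred hno9 htors hodd

end Summit.BirchSwinnertonDyer.BirchSwinnertonDyer.Theorems.WildUpperReducibleNodes

end
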